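import Mathlib
import Summits.ResolutionOfSingularities.ResolutionOfSingularities.Theorems.WildQuotientsWildQuotientResolutionJordanFourChart0Fixed
import Summits.ResolutionOfSingularities.ResolutionOfSingularities.Theorems.WildQuotientsWildQuotientResolutionJordanFourSlotSubst

/-!
# V4U piece 0, B0-b (iii): the `μ₃` PRESENTATION TRANSPORT — `Third112` range `≃` the invariants of the chart-`0` subring

(crux stmt-ResolutionOfSingularities-15640 `WildQuotients.WildQuotientResolution`, line `Sketch`,
sector `|G| = p`; programme V4U of `L/w45c/CHAIN.md` v7.4 §4 row stub-1 (B0-b), the `μ₃` sibling of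
res-type-087's `JordanFour.halfTransportEquiv` (B0-b½, p503660); `L/w45c/V4U-DESIGN.md` §2/§5
(«φ₀ : (presentation of ⅓-cone ⊗ k[d′,pass]) ≃+* invariantsRing(Γ(V₀))»). [OURS · L1 W4.5c] — NOT a
statement of any manuscript; replaces the role of no printed item. Prover res-L1-w45c-stub-1.)

* `subst0 k n a b c d p` — the slot substitution of record `θ₀ : X b ↦ N = X b^p − X a^{p−1} X b`,
  `X c ↦ c′ = ½(2X c − X b² + X aX b)`, `X d ↦ d′ = X d − c′X b − (X b³ − 3X aX b² + 2X a²X b)/6`,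
  `X i ↦ X i` otherwise (the spellings of `ToricExit.mem_adjoin_of_rootChart4_eq`, p490684), with its
  values `subst0_X_*` and `subst0_injective` (= `slotSubst0_injective`, p504443).
* `thirdTransportEquiv R` — for any subalgebra `R`, `R ≃ₐ[k] R.map (subst0 …)`
  (`Subalgebra.equivMapOfInjective`), `coe_thirdTransportEquiv`.
* `chart0_fixedPoints_eq_map_subst0_of_mod_three_eq_one/_two` — B0-b restated with `subst0`:
  `{f ∈ S₀ | σ_U f = f} = (Third112.presentation k n a b c).range.map (subst0 …)` for `p ≡ 1 (mod 3)`,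
  resp. `(Third112.presentation k n b c a).range.map (subst0 …)` for `p ≡ 2 (mod 3)`.
So for piece 0: `k[Y] ⧸ ker (Third112.presentation …) ≃ range (RingHom.quotientKerEquivRange) ≃
range.map subst0 (thirdTransportEquiv) = the σ_U-invariants of the chart-0 subring` — the `φ₀` of
V4U-DESIGN §5 up to res-L1-w45c-stub-2's chart iso p490009 and the equivariance square (stub-3).
-/

-- single-problem summit: the doubled namespace component `ResolutionOfSingularities` is forced
set_option linter.dupNamespace false

noncomputable section

open MvPolynomial

namespace Summit.ResolutionOfSingularities.ResolutionOfSingularities.Theorems.WildQuotientResolution.JordanFour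

section Subst0

variable (k : Type) [Field k] (n : ℕ) (a b c d : Fin n) (p : ℕ)

/-- The slot substitution of record for piece 0: `X b ↦ N`, `X c ↦ c′`, `X d ↦ d′`, `X i ↦ X i`
otherwise. [OURS · L1 W4.5c] -/
noncomputable def subst0 : MvPolynomial (Fin n) k →ₐ[k] MvPolynomial (Fin n) k :=
  MvPolynomial.aeval (fun i : Fin n => if i = b then X b ^ p - X a ^ (p - 1) * X b
    else if i = c then C (2⁻¹ : k) * (2 * X c - X b ^ 2 + X a * X b)
    else if i = d then X d - (C (2⁻¹ : k) * (2 * X c - X b ^ 2 + X a * X b)) * X b -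
      C (6⁻¹ : k) * (X b ^ 3 - 3 * (X a * X b ^ 2) + 2 * (X a ^ 2 * X b))
    else (X i : MvPolynomial (Fin n) k))

/-- `subst0` is the `aeval` of its defining function (definitional bridge to `chart0_fixedPoints_eq_*`
and `slotSubst0_injective`). [folklore] -/
theorem subst0_eq_aeval : subst0 k n a b c d p =
    MvPolynomial.aeval (fun i : Fin n => if i = b then X b ^ p - X a ^ (p - 1) * X b
      else if i = c then C (2⁻¹ : k) * (2 * X c - X b ^ 2 + X a * X b)
      else if i = d then X d - (C (2⁻¹ : k) * (2 * X c - X b ^ 2 + X a * X b)) * X b -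
        C (6⁻¹ : k) * (X b ^ 3 - 3 * (X a * X b ^ 2) + 2 * (X a ^ 2 * X b))
      else (X i : MvPolynomial (Fin n) k)) := rfl

/-- `θ₀(X b) = N`. [folklore] -/
theorem subst0_X_b : subst0 k n a b c d p (X b) = X b ^ p - X a ^ (p - 1) * X b := by
  simp [subst0]

/-- `θ₀(X c) = c′` (`b ≠ c`). [folklore] -/
theorem subst0_X_c (hbc : b ≠ c) :
    subst0 k n a b c d p (X c) = C (2⁻¹ : k) * (2 * X c - X b ^ 2 + X a * X b) := by
  simp [subst0, hbc.symm]

/-- `θ₀(X d) = d′` (`b ≠ d`, `c ≠ d`). [folklore] -/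
theorem subst0_X_d (hbd : b ≠ d) (hcd : c ≠ d) :
    subst0 k n a b c d p (X d) = X d - (C (2⁻¹ : k) * (2 * X c - X b ^ 2 + X a * X b)) * X b -
      C (6⁻¹ : k) * (X b ^ 3 - 3 * (X a * X b ^ 2) + 2 * (X a ^ 2 * X b)) := by
  simp [subst0, hbd.symm, hcd.symm]

/-- `θ₀(X i) = X i` for `i ∉ {b, c, d}` (in particular `θ₀(X a) = X a = ρ`). [folklore] -/
theorem subst0_X_of_ne (i : Fin n) (hib : i ≠ b) (hic : i ≠ c) (hid : i ≠ d) :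
    subst0 k n a b c d p (X i) = X i := by
  simp [subst0, hib, hic, hid]

/-- **`θ₀` is injective** (`char k = p ≥ 5`; `slotSubst0_injective`). [OURS · L1 W4.5c] -/
theorem subst0_injective (hab : a ≠ b) (hbc : b ≠ c) (hbd : b ≠ d) (hcd : c ≠ d)
    (hp : p.Prime) (hp5 : 5 ≤ p) [CharP k p] : Function.Injective (subst0 k n a b c d p) := by
  rw [subst0_eq_aeval]
  exact slotSubst0_injective k n a b c d hab hbc hbd hcd p hp hp5

/-- **The `μ₃` presentation transport**: any subalgebra `R` is isomorphic to its image under the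
injective slot substitution `θ₀`. Use with `R = (Third112.presentation k n a b c).range`
(`p ≡ 1 (mod 3)`) or `R = (Third112.presentation k n b c a).range` (`p ≡ 2 (mod 3)`).
[OURS · L1 W4.5c] -/
noncomputable def thirdTransportEquiv (hab : a ≠ b) (hbc : b ≠ c) (hbd : b ≠ d) (hcd : c ≠ d)
    (hp : p.Prime) (hp5 : 5 ≤ p) [CharP k p] (R : Subalgebra k (MvPolynomial (Fin n) k)) :
    ↥R ≃ₐ[k] ↥(R.map (subst0 k n a b c d p)) :=
  R.equivMapOfInjective _ (subst0_injective k n a b c d p hab hbc hbd hcd hp hp5)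

/-- The transport is `θ₀` on underlying polynomials. [folklore] -/
theorem coe_thirdTransportEquiv (hab : a ≠ b) (hbc : b ≠ c) (hbd : b ≠ d) (hcd : c ≠ d)
    (hp : p.Prime) (hp5 : 5 ≤ p) [CharP k p] (R : Subalgebra k (MvPolynomial (Fin n) k)) (x : R) :
    ((thirdTransportEquiv k n a b c d p hab hbc hbd hcd hp hp5 R x : R.map (subst0 k n a b c d p)) :
        MvPolynomial (Fin n) k) = subst0 k n a b c d p x :=
  rfl

end Subst0

section Fixed

variable (k : Type) [Field k] (n : ℕ)
  (σU : MvPolynomial (Fin n) k ≃ₐ[k] MvPolynomial (Fin n) k) (a b c d : Fin n)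
  (hab : a ≠ b) (hac : a ≠ c) (had : a ≠ d) (hbc : b ≠ c) (hbd : b ≠ d) (hcd : c ≠ d)
  (hb : σU (X b) = X b + X a) (hc : σU (X c) = X c + X a * X b)
  (hd : σU (X d) = X d + X a * X c)
  (hσ : ∀ i, i ≠ b → i ≠ c → i ≠ d → σU (X i) = X i)

include hab hac had hbc hbd hcd hb hc hd hσ in
/-- **B0-b with `subst0`, `p ≡ 1 (mod 3)`**: the `σ_U`-invariants of the chart-`0` subring are
`(Third112.presentation k n a b c).range.map θ₀`. [OURS · L1 W4.5c] -/
theorem chart0_fixedPoints_eq_map_subst0_of_mod_three_eq_one (p : ℕ) (hp : p.Prime) (hp5 : 5 ≤ p)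
    [CharP k p] (hp3 : p % 3 = 1) :
    {f : MvPolynomial (Fin n) k | f ∈ Algebra.adjoin k
        (Set.range (fun s : Fin n => MvPolynomial.aeval
            (fun s : Fin n => (if s = a then X a ^ 3 else
              X s * X a ^ (if s = b then 2 else if s = c then 1 else 0) : MvPolynomial (Fin n) k))
            (X s : MvPolynomial (Fin n) k)) ∪
          Set.range (![1, X a * X b ^ 2, X b * X c, X c ^ 3, X b ^ 3, X b ^ 2 * X c ^ 2,
              X b * X c ^ 4, X c ^ 6] : Fin 8 → MvPolynomial (Fin n) k)) ∧ σU f = f} =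
      (((Third112.presentation k n a b c).range.map (subst0 k n a b c d p)) :
        Set (MvPolynomial (Fin n) k)) :=
  chart0_fixedPoints_eq_of_mod_three_eq_one k n σU a b c d hab hac had hbc hbd hcd hb hc hd hσ p hp hp5 hp3

include hab hac had hbc hbd hcd hb hc hd hσ in
/-- **B0-b with `subst0`, `p ≡ 2 (mod 3)`**: the `σ_U`-invariants of the chart-`0` subring are
`(Third112.presentation k n b c a).range.map θ₀` (permuted triple `(N, c′, ρ)`). [OURS · L1 W4.5c] -/
theorem chart0_fixedPoints_eq_map_subst0_of_mod_three_eq_two (p : ℕ) (hp : p.Prime) (hp5 : 5 ≤ p)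
    [CharP k p] (hp3 : p % 3 = 2) :
    {f : MvPolynomial (Fin n) k | f ∈ Algebra.adjoin k
        (Set.range (fun s : Fin n => MvPolynomial.aeval
            (fun s : Fin n => (if s = a then X a ^ 3 else
              X s * X a ^ (if s = b then 2 else if s = c then 1 else 0) : MvPolynomial (Fin n) k))
            (X s : MvPolynomial (Fin n) k)) ∪
          Set.range (![1, X a * X b ^ 2, X b * X c, X c ^ 3, X b ^ 3, X b ^ 2 * X c ^ 2,
              X b * X c ^ 4, X c ^ 6] : Fin 8 → MvPolynomial (Fin n) k)) ∧ σU f = f} =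
      (((Third112.presentation k n b c a).range.map (subst0 k n a b c d p)) :
        Set (MvPolynomial (Fin n) k)) :=
  chart0_fixedPoints_eq_of_mod_three_eq_two k n σU a b c d hab hac had hbc hbd hcd hb hc hd hσ p hp hp5 hp3

include hab hac had hbc hbd hcd hb hc hd hσ in
/-- The image of any subalgebra under `θ₀` is pointwise `σ_U`-fixed (`θ₀`'s values `ρ, N, c′, d′,
passengers` are invariants). [OURS · L1 W4.5c] -/
theorem map_subst0_fixed (p : ℕ) (hp : p.Prime) (hp5 : 5 ≤ p) [CharP k p]
    (R : Subalgebra k (MvPolynomial (Fin n) k)) (f : MvPolynomial (Fin n) k)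
    (hf : f ∈ R.map (subst0 k n a b c d p)) : σU f = f := by
  -- use the core statement with `R' = ⊤`-free trick: reduce to generators via `chart0_fixedPoints_eq_map`
  -- applied to the weight `w₁ := coneWeight` would need `p ≡ 1`; instead argue directly on generators.
  haveI : Fact p.Prime := ⟨hp⟩
  have h2 : (2 : k) ≠ 0 := two_ne_zero_of_charP k p hp5
  have h3 : (3 : k) ≠ 0 := three_ne_zero_of_charP k p hp5
  have h6 : (6 : k) ≠ 0 := by
    rw [show (6 : k) = 2 * 3 by norm_num]; exact mul_ne_zero h2 h3
  have ha : σU (X a) = X a := hσ a hab hac had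
  have key : (σU : MvPolynomial (Fin n) k →ₐ[k] MvPolynomial (Fin n) k).comp (subst0 k n a b c d p) =
      subst0 k n a b c d p := by
    refine MvPolynomial.algHom_ext fun i => ?_
    change σU (subst0 k n a b c d p (X i)) = subst0 k n a b c d p (X i)
    by_cases hib : i = b
    · rw [hib, subst0_X_b]
      exact ToricExit.rootChart4_artinSchreier
        (σU : MvPolynomial (Fin n) k →+* MvPolynomial (Fin n) k) a b ha hb p
    by_cases hic : i = c
    · rw [hic, subst0_X_c k n a b c d p hbc]
      exact ToricExit.rootChart4_half_gamma_invariant k n σU a b c d hab hac had hb hc hσ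
    by_cases hid : i = d
    · rw [hid, subst0_X_d k n a b c d p hbd hcd]
      exact ToricExit.rootChart4_dPrime k n σU a b c d hab hac had hb hc hd hσ h2 h6
    · rw [subst0_X_of_ne k n a b c d p i hib hic hid, hσ i hib hic hid]
  obtain ⟨P, -, rfl⟩ := Subalgebra.mem_map.mp hf
  exact congrArg (fun φ : MvPolynomial (Fin n) k →ₐ[k] MvPolynomial (Fin n) k => φ P) key

end Fixed

end Summit.ResolutionOfSingularities.ResolutionOfSingularities.Theorems.WildQuotientResolution.JordanFour

end
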